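import Summits.CriticalPhenomena.CardyFormulaZ2.Theorems.CardyUniqueLimitCardyRigidityMartingaleOfDataPath
import Literature.Probability.RandomPlanarGeometry.LoewnerRealFlowGapAntitone
import Literature.Probability.RandomPlanarGeometry.SLEKappaRhoFlow
import HarnessLib

/-!
# Cut-1 of STUB A3b, flow side: the marks of the real Loewner flow just after the level time

Crux `Summit.CriticalPhenomena.CardyFormulaZ2.Theses.CardyUniqueLimit.CardyRigidity`
(stmt-CriticalPhenomena-0746), line `crossing_martingale`, stub A3b `stub_slitObservableApprox`,
cut "freezing at the level step" (Camia–Newman 2007, §5).  At the level step `ν` the capacity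
time `T_ν` of the explored piece lies in a window `[ρ, ρ + Δ_k]` just after the level time `ρ`
of the marks; the cut compares `f(η_{T_ν})` with the frozen value `f(η_ρ)` and needs `T_ν` to
be before the level time of RELAXED levels.  This file proves the real-variable facts:

* `AdmissibleLevels.relax` — `(m/2, M+1, d/2)` is admissible when `(m, M, d)` is;
* `SlitCardyCut.abs_realFlowStop_sub_le_of_osc` — time-regularity of one frozen real flow
  `X^y` on a window on which the driver oscillates by `≤ κ ≤ c/2`, `c ≤ X^y_ρ`: the mark stays
  alive, `X^y ≥ c/2`, `|X^y_t - X^y_ρ| ≤ κ + 4Δ/c` (real Loewner equation in integrated form,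
  `Loewner.realFlowStop_eq_sub_add_integral`);
* `SlitCardyCut.levelTime_le_iff_of_eqOn` — the level time is decided by the driver up to that
  time (`Loewner.realFlowStop_eq_of_eqOn`); `coe_lt_levelTime_of_forall` — `T < levelTime`
  from the open level box on `[0, T]`;
* `SlitCardyCut.marks_window`, `coe_lt_levelTime_relax` — on `[ρ, ρ + Δ]` the marks move by
  `≤ μ₀` and the clock is before the relaxed level time (gaps never exceed their initial
  values, `Loewner.realFlowStop_sub_realFlowStop_le_sub`);
* the comparison `|f(η_t) - f(η_ρ)| < κ₁` on the window is `…SlitCardyCutEta.lean`.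
-/

noncomputable section

open MeasureTheory Filter Set Topology Metric
open scoped NNReal ENNReal Interval
open Literature.Probability Literature.Probability.RandomPlanarGeometry

namespace Summit.CriticalPhenomena.CardyFormulaZ2.Cruxes.CardyRigidity.CrossingMartingale

/-- Relaxed levels `(m/2, M+1, d/2)` of admissible levels are admissible. [folklore] -/
theorem AdmissibleLevels.relax {x : Fin 3 → ℝ} {m M d : ℝ} (h : AdmissibleLevels x m M d) :
    AdmissibleLevels x (m / 2) (M + 1) (d / 2) where
  strictMono := h.strictMono
  pos := h.pos
  m_pos := by linarith [h.m_pos]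
  m_lt := by linarith [h.m_pos, h.m_lt]
  lt_M := by linarith [h.lt_M]
  d_pos := by linarith [h.d_pos]
  d_lt₁ := by linarith [h.d_pos, h.d_lt₁]
  d_lt₂ := by linarith [h.d_pos, h.d_lt₂]

namespace SlitCardyCut

open Loewner Literature.Probability.Process

/-! ### Time-regularity of one frozen real flow on a window of small driver oscillation -/

section Flow

variable {W : ℝ≥0 → ℝ} {y : ℝ}

/-- The integrand `2 / X^y` of the real Loewner equation is continuous on `[0, t]` while `y` is
alive at time `t`. [cite: Lawler2005, Ch. 4 §4.1] -/
theorem continuousOn_two_div_realFlowStop (hW : Continuous W) (hy : W 0 < y) {t : ℝ≥0}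
    (ht : (t : WithTop ℝ≥0) < swallowingTime W y) :
    ContinuousOn (fun u : ℝ ↦ 2 / realFlowStop W y u.toNNReal) (Icc 0 t) := by
  refine continuousOn_const.div
    ((continuous_realFlowStop hW hy).comp continuous_real_toNNReal).continuousOn fun u hu ↦ ?_
  have hu' : (u.toNNReal : WithTop ℝ≥0) < swallowingTime W y :=
    lt_of_le_of_lt (WithTop.coe_le_coe.2 (Real.toNNReal_le_iff_le_coe.2 hu.2)) ht
  exact ((realFlowStop_pos_iff hW hy).2 hu').ne'

/-- **The real Loewner equation between two times**: for `s ≤ t < T_y`,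
`X_t - X_s + (W_t - W_s) = ∫_s^t 2 / X_u du`. [cite: Lawler2005, Prop. 1.21] -/
theorem realFlowStop_sub_add_eq_integral (hW : Continuous W) (hy : W 0 < y) {s t : ℝ≥0}
    (hst : s ≤ t) (ht : (t : WithTop ℝ≥0) < swallowingTime W y) :
    realFlowStop W y t - realFlowStop W y s + (W t - W s) =
      ∫ u in (s : ℝ)..t, 2 / realFlowStop W y u.toNNReal := by
  have hs : (s : WithTop ℝ≥0) < swallowingTime W y := lt_of_le_of_lt (WithTop.coe_le_coe.2 hst) ht
  have h1 := realFlowStop_eq_sub_add_integral hW hy.ne' ht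
  have h2 := realFlowStop_eq_sub_add_integral hW hy.ne' hs
  have hc := continuousOn_two_div_realFlowStop hW hy ht
  have hIt : IntervalIntegrable (fun u : ℝ ↦ 2 / realFlowStop W y u.toNNReal) volume 0 t :=
    hc.intervalIntegrable_of_Icc t.coe_nonneg
  have hIs : IntervalIntegrable (fun u : ℝ ↦ 2 / realFlowStop W y u.toNNReal) volume 0 s :=
    (hc.mono (Icc_subset_Icc_right (NNReal.coe_le_coe.2 hst))).intervalIntegrable_of_Icc s.coe_nonneg
  rw [← intervalIntegral.integral_interval_sub_left hIt hIs, h1, h2]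
  ring

/-- **Time-regularity of a frozen real flow on a window of small driver oscillation.**  Let
`0 < c ≤ X^y_ρ` and suppose the driver oscillates by at most `κ ≤ c/2` on `[ρ, ρ + Δ]`.  Then
on that window the mark `y` is alive, `X^y ≥ c/2`, and `|X^y_t - X^y_ρ| ≤ κ + 4Δ/c`
(`X_t - X_ρ = -(W_t - W_ρ) + ∫_ρ^t 2/X`, the integral being `≥ 0` and `≤ 4(t-ρ)/c`).
[cite: Lawler2005, Ch. 4 §4.1] -/
theorem abs_realFlowStop_sub_le_of_osc (hW : Continuous W) (hy : W 0 < y) {ρ Δ : ℝ≥0}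
    {c κ : ℝ} (hc : 0 < c) (hκc : κ ≤ c / 2) (hρ : c ≤ realFlowStop W y ρ)
    (hosc : ∀ t : ℝ≥0, ρ ≤ t → t ≤ ρ + Δ → |W t - W ρ| ≤ κ) {t : ℝ≥0} (hρt : ρ ≤ t)
    (htΔ : t ≤ ρ + Δ) :
    (t : WithTop ℝ≥0) < swallowingTime W y ∧ c / 2 ≤ realFlowStop W y t ∧
      |realFlowStop W y t - realFlowStop W y ρ| ≤ κ + 4 * Δ / c := by
  set X := realFlowStop W y with hX
  have hXc : Continuous X := continuous_realFlowStop hW hy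
  have hF0 : ∀ u : ℝ, 0 ≤ 2 / X u.toNNReal := fun u ↦
    div_nonneg zero_le_two (realFlowStop_nonneg hW hy _)
  -- Step 1: lower bound while alive
  have step1 : ∀ u : ℝ≥0, ρ ≤ u → u ≤ ρ + Δ → (u : WithTop ℝ≥0) < swallowingTime W y →
      -κ ≤ X u - X ρ ∧ c / 2 ≤ X u := by
    intro u hρu huΔ hu
    have hI := realFlowStop_sub_add_eq_integral hW hy hρu hu
    have hnn : 0 ≤ ∫ v in (ρ : ℝ)..u, 2 / realFlowStop W y v.toNNReal :=
      intervalIntegral.integral_nonneg (NNReal.coe_le_coe.2 hρu) fun v _ ↦ hF0 v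
    have hWu := (abs_le.1 (hosc u hρu huΔ)).2
    have h1 : -κ ≤ X u - X ρ := by rw [hX]; linarith
    exact ⟨h1, by linarith⟩
  -- Step 2: the mark is alive on the whole window
  have halive : (t : WithTop ℝ≥0) < swallowingTime W y := by
    by_contra hle
    have hTt : swallowingTime W y ≤ t := not_lt.1 hle
    obtain ⟨T₀, hT₀⟩ := WithTop.ne_top_iff_exists.1 (ne_top_of_le_ne_top WithTop.coe_ne_top hTt)
    have hρT : (ρ : WithTop ℝ≥0) < swallowingTime W y :=
      (realFlowStop_pos_iff hW hy).1 (hc.trans_le hρ)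
    rw [← hT₀] at hρT hTt
    have hρT₀ : ρ < T₀ := WithTop.coe_lt_coe.1 hρT
    have hT₀t : T₀ ≤ t := WithTop.coe_le_coe.1 hTt
    have hX0 : X T₀ = 0 := realFlowStop_of_le (by rw [← hT₀])
    have hS : IsClosed {u : ℝ≥0 | c / 2 ≤ X u} := isClosed_le continuous_const hXc
    have hsub : Ico ρ T₀ ⊆ {u : ℝ≥0 | c / 2 ≤ X u} := fun u hu ↦
      (step1 u hu.1 (hu.2.le.trans (hT₀t.trans htΔ)) (by rw [← hT₀]; exact WithTop.coe_lt_coe.2 hu.2)).2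
    have hmem : T₀ ∈ {u : ℝ≥0 | c / 2 ≤ X u} := by
      refine hS.closure_subset_iff.2 hsub ?_
      rw [closure_Ico hρT₀.ne]
      exact right_mem_Icc.2 hρT₀.le
    have : c / 2 ≤ X T₀ := hmem
    rw [hX0] at this
    linarith
  obtain ⟨hlow, hc2⟩ := step1 t hρt htΔ halive
  refine ⟨halive, hc2, abs_le.2 ⟨by linarith [div_nonneg (mul_nonneg zero_le_four Δ.coe_nonneg) hc.le], ?_⟩⟩
  -- Step 3: upper bound through the integral
  have hI := realFlowStop_sub_add_eq_integral hW hy hρt halive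
  have hbound : ∀ v ∈ Ι (ρ : ℝ) t, ‖2 / realFlowStop W y v.toNNReal‖ ≤ 4 / c := by
    intro v hv
    rw [uIoc_of_le (NNReal.coe_le_coe.2 hρt)] at hv
    have hv0 : 0 ≤ v := ρ.coe_nonneg.trans hv.1.le
    have hρv : ρ ≤ v.toNNReal := (Real.le_toNNReal_iff_coe_le hv0).2 hv.1.le
    have hvt : v.toNNReal ≤ t := Real.toNNReal_le_iff_le_coe.2 hv.2
    have hva : (v.toNNReal : WithTop ℝ≥0) < swallowingTime W y :=
      lt_of_le_of_lt (WithTop.coe_le_coe.2 hvt) halive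
    have h2 := (step1 _ hρv (hvt.trans htΔ) hva).2
    rw [Real.norm_eq_abs, abs_of_nonneg (hF0 v)]
    calc 2 / realFlowStop W y v.toNNReal ≤ 2 / (c / 2) :=
          div_le_div_of_nonneg_left zero_le_two (by positivity) h2
      _ = 4 / c := by field_simp; ring
  have hint := intervalIntegral.norm_integral_le_of_norm_le_const hbound
  rw [Real.norm_eq_abs] at hint
  have habs : |(t : ℝ) - ρ| ≤ Δ := by
    have h1 : ((ρ : ℝ≥0) : ℝ) ≤ t := by exact_mod_cast hρt
    rw [abs_of_nonneg (sub_nonneg.2 h1)]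
    have : ((t : ℝ≥0) : ℝ) ≤ ρ + Δ := by exact_mod_cast htΔ
    linarith
  have hle := (le_abs_self _).trans hint
  have hWt := (abs_le.1 (hosc t hρt htΔ)).1
  have h4 : 4 / c * |(t : ℝ) - ρ| ≤ 4 * Δ / c := by
    rw [div_mul_eq_mul_div]
    exact div_le_div_of_nonneg_right (by nlinarith) hc.le
  rw [hX]
  linarith

end Flow

/-! ### Level times: locality in the driver, characterisation of `T < levelTime` -/

section Levels

variable {x : Fin 3 → ℝ} {m M d : ℝ}

/-- An exit time `≤ s` is decided by the path up to time `s` (continuous paths). [folklore] -/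
theorem exitTime_le_iff_of_eqOn {Ω₁ : Type*} {u u' : ℝ≥0 → Ω₁ → ℝ} {ω ω' : Ω₁} {a b : ℝ}
    (hc : Continuous fun t ↦ u t ω) (hc' : Continuous fun t ↦ u' t ω') {s : ℝ≥0}
    (h : ∀ j, j ≤ s → u j ω = u' j ω') :
    exitTime u a b ω ≤ s ↔ exitTime u' a b ω' ≤ s := by
  rw [exitTime_le_coe_iff hc, exitTime_le_coe_iff hc']
  exact exists_congr fun j ↦ and_congr_right fun hj ↦ by rw [h j hj]

/-- **The level time is decided by the driver up to that time**: if two continuous driving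
paths agree on `[0, s]`, then `levelTime ≤ s` holds for one iff for the other
(`Loewner.realFlowStop_eq_of_eqOn`). [cite: Lawler2005, Ch. 4 §4.1] -/
theorem levelTime_le_iff_of_eqOn {w w' : C(ℝ≥0, ℝ)} {s : ℝ≥0} (h : ∀ r, r ≤ s → w r = w' r)
    (x : Fin 3 → ℝ) (m M d : ℝ) :
    levelTime (fun (w : C(ℝ≥0, ℝ)) (r : ℝ≥0) ↦ w r) x m M d w ≤ s ↔
      levelTime (fun (w : C(ℝ≥0, ℝ)) (r : ℝ≥0) ↦ w r) x m M d w' ≤ s := by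
  have hmk : ∀ (y : ℝ) (j : ℝ≥0), j ≤ s →
      markFlow (fun (w : C(ℝ≥0, ℝ)) (r : ℝ≥0) ↦ w r) y j w =
        markFlow (fun (w : C(ℝ≥0, ℝ)) (r : ℝ≥0) ↦ w r) y j w' := fun y j hj ↦
    (realFlowStop_eq_of_eqOn w.continuous w'.continuous h hj).symm
  have hcm : ∀ (v : C(ℝ≥0, ℝ)) (y : ℝ),
      Continuous fun j ↦ markFlow (fun (w : C(ℝ≥0, ℝ)) (r : ℝ≥0) ↦ w r) y j v := fun v y ↦
    MartingaleOfData.continuous_markFlow_pt (W := fun (w : C(ℝ≥0, ℝ)) (r : ℝ≥0) ↦ w r) v.continuous y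
  simp only [levelTime, min_le_iff]
  rw [exitTime_le_iff_of_eqOn (hcm w (x 0)) (hcm w' (x 0)) (hmk (x 0)),
    exitTime_le_iff_of_eqOn (u := fun t v ↦ markFlow _ (x 1) t v - markFlow _ (x 0) t v)
      (u' := fun t v ↦ markFlow _ (x 1) t v - markFlow _ (x 0) t v)
      ((hcm w (x 1)).sub (hcm w (x 0))) ((hcm w' (x 1)).sub (hcm w' (x 0)))
      (fun j hj ↦ by simp only [hmk _ j hj]),
    exitTime_le_iff_of_eqOn (u := fun t v ↦ markFlow _ (x 2) t v - markFlow _ (x 1) t v)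
      (u' := fun t v ↦ markFlow _ (x 2) t v - markFlow _ (x 1) t v)
      ((hcm w (x 2)).sub (hcm w (x 1))) ((hcm w' (x 2)).sub (hcm w' (x 1)))
      (fun j hj ↦ by simp only [hmk _ j hj])]

variable {Ω : Type*} {W : Ω → ℝ≥0 → ℝ} {ω : Ω}

/-- **`T < levelTime` from the level box**: if on `[0, T]` the first mark flow is in `(m, M)`
and the two gaps are in `(d, x₂ - x₀ + 1)`, then `T` is strictly before the level time
(continuous driving path). [cite: Werner2007, §3] -/
theorem coe_lt_levelTime_of_forall (hc : Continuous (W ω)) {T : ℝ≥0}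
    (h : ∀ j : ℝ≥0, j ≤ T → markFlow W (x 0) j ω ∈ Ioo m M ∧
      markFlow W (x 1) j ω - markFlow W (x 0) j ω ∈ Ioo d (x 2 - x 0 + 1) ∧
      markFlow W (x 2) j ω - markFlow W (x 1) j ω ∈ Ioo d (x 2 - x 0 + 1)) :
    (T : WithTop ℝ≥0) < levelTime W x m M d ω := by
  have hcm := fun y ↦ MartingaleOfData.continuous_markFlow_pt (W := W) hc y
  refine lt_min ?_ (lt_min ?_ ?_)
  · refine lt_of_not_ge fun hle ↦ ?_
    obtain ⟨j, hj, hnot⟩ := (exitTime_le_coe_iff (hcm (x 0))).1 hle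
    exact hnot (h j hj).1
  · refine lt_of_not_ge fun hle ↦ ?_
    obtain ⟨j, hj, hnot⟩ := (exitTime_le_coe_iff
      (u := fun t ω ↦ markFlow W (x 1) t ω - markFlow W (x 0) t ω)
      ((hcm (x 1)).sub (hcm (x 0)))).1 hle
    exact hnot (h j hj).2.1
  · refine lt_of_not_ge fun hle ↦ ?_
    obtain ⟨j, hj, hnot⟩ := (exitTime_le_coe_iff
      (u := fun t ω ↦ markFlow W (x 2) t ω - markFlow W (x 1) t ω)
      ((hcm (x 2)).sub (hcm (x 1)))).1 hle
    exact hnot (h j hj).2.2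

/-- Strictly before the level time the marks are in the open level box. [cite: Werner2007, §3] -/
theorem marks_mem_Ioo_of_coe_lt_levelTime {j : ℝ≥0} (hj : (j : WithTop ℝ≥0) < levelTime W x m M d ω) :
    markFlow W (x 0) j ω ∈ Ioo m M ∧
      markFlow W (x 1) j ω - markFlow W (x 0) j ω ∈ Ioo d (x 2 - x 0 + 1) ∧
      markFlow W (x 2) j ω - markFlow W (x 1) j ω ∈ Ioo d (x 2 - x 0 + 1) :=
  ⟨mem_Ioo_of_coe_lt_exitTime (hj.trans_le (min_le_left _ _)),
    mem_Ioo_of_coe_lt_exitTime (u := fun t ω ↦ markFlow W (x 1) t ω - markFlow W (x 0) t ω)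
      (hj.trans_le ((min_le_right _ _).trans (min_le_left _ _))),
    mem_Ioo_of_coe_lt_exitTime (u := fun t ω ↦ markFlow W (x 2) t ω - markFlow W (x 1) t ω)
      (hj.trans_le ((min_le_right _ _).trans (min_le_right _ _)))⟩

/-- Strictly before the level time one is strictly before the RELAXED level time
(levels `(m/2, M+1, d/2)`). [cite: Werner2007, §3] -/
theorem coe_lt_levelTime_relax_of_lt (hc : Continuous (W ω)) (h : AdmissibleLevels x m M d)
    {T : ℝ≥0} (hT : (T : WithTop ℝ≥0) < levelTime W x m M d ω) :
    (T : WithTop ℝ≥0) < levelTime W x (m / 2) (M + 1) (d / 2) ω := by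
  refine coe_lt_levelTime_of_forall hc fun j hj ↦ ?_
  obtain ⟨h0, h1, h2⟩ := marks_mem_Ioo_of_coe_lt_levelTime ((WithTop.coe_le_coe.2 hj).trans_lt hT)
  exact ⟨⟨by linarith [h0.1, h.m_pos], by linarith [h0.2]⟩, ⟨by linarith [h1.1, h.d_pos], h1.2⟩,
    ⟨by linarith [h2.1, h.d_pos], h2.2⟩⟩

/-! ### The marks just after the level time -/

/-- **The marks move little on the window `[ρ, ρ + Δ]` after the level time `ρ`.**  For a
continuous driving path with `W 0 = 0`, admissible `(x; m, M, d)`, `ρ` at most the level time,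
a driver oscillation `≤ κ` on the window and `κ + 4Δ/m ≤ μ₀ ≤ m/4`: every mark stays alive and
moves by at most `μ₀` on the window. [cite: Lawler2005, Ch. 4 §4.1] -/
theorem marks_window (hc : Continuous (W ω)) (hW0 : W ω 0 = 0) (h : AdmissibleLevels x m M d)
    {ρ Δ : ℝ≥0} (hρ : (ρ : WithTop ℝ≥0) ≤ levelTime W x m M d ω) {κ μ₀ : ℝ}
    (hμm : μ₀ ≤ m / 4) (hκμ : κ + 4 * Δ / m ≤ μ₀)
    (hosc : ∀ t : ℝ≥0, ρ ≤ t → t ≤ ρ + Δ → |W ω t - W ω ρ| ≤ κ) {t : ℝ≥0} (hρt : ρ ≤ t)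
    (htΔ : t ≤ ρ + Δ) (i : Fin 3) :
    (t : WithTop ℝ≥0) < swallowingTime (W ω) (x i) ∧
      |markFlow W (x i) t ω - markFlow W (x i) ρ ω| ≤ μ₀ := by
  have hw : W ω 0 ∈ Ioo (x 0 - M) (x 0 - m) := by
    rw [hW0]; exact ⟨by linarith [h.pos, h.lt_M], by linarith [h.m_lt]⟩
  obtain ⟨hX0, hg1, hg2⟩ := MartingaleOfData.marks_mem_box_pt hc h hw hρ
  have hmi : m ≤ markFlow W (x i) ρ ω := by
    fin_cases i
    · exact hX0.1
    · show m ≤ markFlow W (x 1) ρ ω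
      linarith [hX0.1, hg1.1, h.d_pos]
    · show m ≤ markFlow W (x 2) ρ ω
      linarith [hX0.1, hg1.1, hg2.1, h.d_pos]
  have hyi : W ω 0 < x i := by
    rw [hW0]; exact h.pos.trans_le (h.strictMono.monotone (Fin.zero_le i))
  have hΔm : 0 ≤ 4 * (Δ : ℝ) / m := div_nonneg (by positivity) h.m_pos.le
  have hκc : κ ≤ m / 2 := by linarith [h.m_pos]
  obtain ⟨halive, -, hdisp⟩ := abs_realFlowStop_sub_le_of_osc hc hyi h.m_pos hκc hmi hosc hρt htΔ
  exact ⟨halive, hdisp.trans hκμ⟩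

/-- **Just after the level time the clock is still before the RELAXED level time.**  In the
setting of `marks_window` with moreover `μ₀ ≤ d/8`, `μ₀ < 1`: every `t ∈ [ρ, ρ + Δ]` is strictly
before the level time of the relaxed levels `(m/2, M+1, d/2)` (before `ρ` the marks are in the
original open box; after, they have moved by `≤ μ₀`, and the gaps never exceed their initial
values, `Loewner.realFlowStop_sub_realFlowStop_le_sub`). [cite: Lawler2005, Ch. 4 §4.1] -/
theorem coe_lt_levelTime_relax (hc : Continuous (W ω)) (hW0 : W ω 0 = 0)
    (h : AdmissibleLevels x m M d) {ρ Δ : ℝ≥0} (hρ : levelTime W x m M d ω = ρ) {κ μ₀ : ℝ}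
    (hμm : μ₀ ≤ m / 4) (hμd : μ₀ ≤ d / 8) (hμ1 : μ₀ < 1) (hκμ : κ + 4 * Δ / m ≤ μ₀)
    (hosc : ∀ t : ℝ≥0, ρ ≤ t → t ≤ ρ + Δ → |W ω t - W ω ρ| ≤ κ) {t : ℝ≥0}
    (htΔ : t ≤ ρ + Δ) :
    (t : WithTop ℝ≥0) < levelTime W x (m / 2) (M + 1) (d / 2) ω := by
  have hx01 : x 0 < x 1 := h.strictMono (by decide)
  have hx12 : x 1 < x 2 := h.strictMono (by decide)
  have hw : W ω 0 ∈ Ioo (x 0 - M) (x 0 - m) := by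
    rw [hW0]; exact ⟨by linarith [h.pos, h.lt_M], by linarith [h.m_lt]⟩
  have hρle : (ρ : WithTop ℝ≥0) ≤ levelTime W x m M d ω := hρ.symm.le
  obtain ⟨hX0, hg1, hg2⟩ := MartingaleOfData.marks_mem_box_pt hc h hw hρle
  have hy : ∀ i, W ω 0 < x i := fun i ↦ by
    rw [hW0]; exact h.pos.trans_le (h.strictMono.monotone (Fin.zero_le i))
  refine coe_lt_levelTime_of_forall hc fun j hj ↦ ?_
  rcases lt_or_ge j ρ with hjρ | hjρ
  · have hj' : (j : WithTop ℝ≥0) < levelTime W x m M d ω := by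
      rw [hρ]; exact WithTop.coe_lt_coe.2 hjρ
    obtain ⟨h0, h1, h2⟩ := marks_mem_Ioo_of_coe_lt_levelTime hj'
    exact ⟨⟨by linarith [h0.1, h.m_pos], by linarith [h0.2]⟩, ⟨by linarith [h1.1, h.d_pos], h1.2⟩,
      ⟨by linarith [h2.1, h.d_pos], h2.2⟩⟩
  · have hjΔ : j ≤ ρ + Δ := hj.trans htΔ
    have hwin := fun i ↦ marks_window hc hW0 h hρle hμm hκμ hosc hjρ hjΔ i
    have e0 := abs_le.1 (hwin 0).2
    have e1 := abs_le.1 (hwin 1).2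
    have e2 := abs_le.1 (hwin 2).2
    have hgap1 : markFlow W (x 1) j ω - markFlow W (x 0) j ω ≤ x 1 - x 0 :=
      realFlowStop_sub_realFlowStop_le_sub hc (hy 0) hx01 (hwin 0).1
    have hgap2 : markFlow W (x 2) j ω - markFlow W (x 1) j ω ≤ x 2 - x 1 :=
      realFlowStop_sub_realFlowStop_le_sub hc (hy 1) hx12 (hwin 1).1
    refine ⟨⟨?_, ?_⟩, ⟨?_, ?_⟩, ⟨?_, ?_⟩⟩
    · linarith [hX0.1, h.m_pos, e0.1]
    · linarith [hX0.2, e0.2]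
    · linarith [hg1.1, h.d_pos, e0.2, e1.1]
    · linarith
    · linarith [hg2.1, h.d_pos, e1.2, e2.1]
    · linarith


end Levels

end SlitCardyCut

/-- **Anchor of this file** (cut-1 of STUB A3b, flow side): the time-regularity of a frozen
real Loewner flow on a window of small driver oscillation, fully explicit form of
`SlitCardyCut.abs_realFlowStop_sub_le_of_osc`. [cite: Lawler2005, Ch. 4 §4.1] -/
theorem slitCardyCut_abs_realFlowStop_sub_le_of_osc : ∀ {W : NNReal → ℝ} {y : ℝ}, Continuous W → W 0 < y → ∀ {ρ Δ : NNReal} {c κ : ℝ}, 0 < c → κ ≤ c / 2 → c ≤ Literature.Probability.RandomPlanarGeometry.Loewner.realFlowStop W y ρ → (∀ t : NNReal, ρ ≤ t → t ≤ ρ + Δ → |W t - W ρ| ≤ κ) → ∀ {t : NNReal}, ρ ≤ t → t ≤ ρ + Δ → (t : WithTop NNReal) < Literature.Probability.RandomPlanarGeometry.Loewner.swallowingTime W y ∧ c / 2 ≤ Literature.Probability.RandomPlanarGeometry.Loewner.realFlowStop W y t ∧ |Literature.Probability.RandomPlanarGeometry.Loewner.realFlowStop W y t - Literature.Probability.RandomPlanarGeometry.Loewner.realFlowStop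 W y ρ| ≤ κ + 4 * Δ / c :=
  fun hW hy _ _ _ _ hc hκc hρ hosc _ hρt htΔ ↦
    SlitCardyCut.abs_realFlowStop_sub_le_of_osc hW hy hc hκc hρ hosc hρt htΔ

end Summit.CriticalPhenomena.CardyFormulaZ2.Cruxes.CardyRigidity.CrossingMartingale

end
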